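import Mathlib
import Summits.MatrixMultiplication.MatrixMultiplication.Theses.ToricBorderRank
import Summits.MatrixMultiplication.MatrixMultiplication.Theorems.ToricBorderRankHilbertMumfordHalfBackward
import Summits.MatrixMultiplication.MatrixMultiplication.Theorems.ToricBorderRankHilbertMumfordHalfStraighten
import Literature.RepresentationTheory.AlgebraicGroups.HilbertMumfordClosedOrbitTensor
import Literature.Computability.AlgebraicComplexity.MatMulPolystableProofs

/-!
# `HilbertMumfordHalf` from the Hilbert–Mumford criterion (Kempf 1978, Thm. 1.4)

Route `ToricBorderRank` of `MatrixMultiplication`, support item `HilbertMumfordHalf`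
(stmt-MatrixMultiplication-9968): for every `n` and every tensor `T` of the format of `⟨n,n,n⟩`,
`⟨n,n,n⟩ ∈ cl(SL³·T)` iff some `SL³`-translate of `T` is a toric parent of `⟨n,n,n⟩` (integer
diagonal weights with (W0) on the support and (W1) on the closed negative half-space).

* (⇐) is `hilbertMumfordHalf_mpr` (`ToricBorderRankHilbertMumfordHalfBackward.lean`, unconditional).
* (⇒) (`hilbertMumfordHalf_mp_of_kempf`) is proved here from ONE named fact, the Hilbert–Mumford
  criterion in Kempf's closed-orbit form for `SL³` acting on `3`-tensors
  (`Literature.RepresentationTheory.AlgebraicGroups.Kempf1978_thm14_tensor`); everything else is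
  proved in the tree: `⟨n,n,n⟩` is polystable (`BurgisserIkenmeyer2017_cor49_matMulTensor_holds`,
  Kempf–Ness), so the criterion yields `k, g ∈ SL³` and weights `(α,β,γ)` with `k·T` vanishing on
  negative cells and `g·⟨n,n,n⟩ =` the weight-zero truncation of `k·T`; the torus-straightening
  theorem `straighten` (de Groote's isotropy Lie algebra + diagonalisability of Kronecker sums)
  gives a graded `s ∈ SL³` with `s·g·⟨n,n,n⟩ = ⟨n,n,n⟩` and new weights `(α',β',γ')`; then
  `(s k)·T` is a toric parent of `⟨n,n,n⟩` for `(α',β',γ')`: (W0) by gradedness of `s` and the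
  support of `g·⟨n,n,n⟩`, (W1) because on every term of `(s·(k·T))_{abc}` with nonzero
  `s`-coefficients the inner cell has weight `α' a + β' b + γ' c ≤ 0`, where `k·T` and
  `g·⟨n,n,n⟩` agree.
* `hilbertMumfordHalf_of_kempf : Kempf1978_thm14_tensor → HilbertMumfordHalf` — the item CLOSED
  MODULO the named fact (conditional result; trust base: Kempf 1978 Thm. 1.4 for `SL_m(ℂ)³` on
  `ℂ^m ⊗ ℂ^m ⊗ ℂ^m`).
-/

set_option linter.dupNamespace false

namespace Summit.MatrixMultiplication.MatrixMultiplication.Theorems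

open scoped BigOperators
open Matrix
open Literature.Computability.AlgebraicComplexity
open Literature.RepresentationTheory.AlgebraicGroups

/-- **`HilbertMumfordHalf`, direction (⇒), from Kempf's criterion.** If `⟨n,n,n⟩` lies in the
closure of the `SL³`-orbit of `T`, then some `SL³`-translate of `T` is a toric parent of
`⟨n,n,n⟩`. -/
theorem hilbertMumfordHalf_mp_of_kempf (hK : Kempf1978_thm14_tensor) (n : ℕ)
    (T : Fin n × Fin n → Fin n × Fin n → Fin n × Fin n → ℂ)
    (hcl : Literature.Computability.AlgebraicComplexity.matMulTensor ℂ n n n ∈ closure (Set.range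
      fun g : Matrix.SpecialLinearGroup (Fin n × Fin n) ℂ ×
          Matrix.SpecialLinearGroup (Fin n × Fin n) ℂ ×
          Matrix.SpecialLinearGroup (Fin n × Fin n) ℂ =>
        (fun a b c => ∑ a', ∑ b', ∑ c', (g.1 : Matrix (Fin n × Fin n) (Fin n × Fin n) ℂ) a a' *
          (g.2.1 : Matrix (Fin n × Fin n) (Fin n × Fin n) ℂ) b b' *
          (g.2.2 : Matrix (Fin n × Fin n) (Fin n × Fin n) ℂ) c c' * T a' b' c'))) :
    ∃ (g : Matrix.SpecialLinearGroup (Fin n × Fin n) ℂ ×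
        Matrix.SpecialLinearGroup (Fin n × Fin n) ℂ × Matrix.SpecialLinearGroup (Fin n × Fin n) ℂ)
        (α β γ : Fin n × Fin n → ℤ),
        (∀ a b c, Literature.Computability.AlgebraicComplexity.matMulTensor ℂ n n n a b c ≠ 0 →
          α a + β b + γ c = 0) ∧
        (∀ a b c, α a + β b + γ c ≤ 0 → ∑ a', ∑ b', ∑ c',
          (g.1 : Matrix (Fin n × Fin n) (Fin n × Fin n) ℂ) a a' *
          (g.2.1 : Matrix (Fin n × Fin n) (Fin n × Fin n) ℂ) b b' *
          (g.2.2 : Matrix (Fin n × Fin n) (Fin n × Fin n) ℂ) c c' * T a' b' c' =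
            Literature.Computability.AlgebraicComplexity.matMulTensor ℂ n n n a b c) := by
  rcases Nat.eq_zero_or_pos n with rfl | hn
  · exact ⟨1, 0, 0, 0, fun a => a.1.elim0, fun a => a.1.elim0⟩
  -- polystability of `⟨n,n,n⟩` (proved in the tree) and Kempf's criterion
  have hclosed := BurgisserIkenmeyer2017_cor49_matMulTensor_holds n
  obtain ⟨k, g, α, β, γ, -, -, -, hP1, hP2⟩ :=
    hK (Fin n × Fin n) T (matMulTensor ℂ n n n) hclosed hcl
  -- in `actTensor` form
  have hP1' : ∀ a b c, α a + β b + γ c < 0 →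
      actTensor (k.1 : Matrix (Fin n × Fin n) (Fin n × Fin n) ℂ)
        (k.2.1 : Matrix (Fin n × Fin n) (Fin n × Fin n) ℂ)
        (k.2.2 : Matrix (Fin n × Fin n) (Fin n × Fin n) ℂ) T a b c = 0 := hP1
  have hP2' : ∀ a b c,
      actTensor (g.1 : Matrix (Fin n × Fin n) (Fin n × Fin n) ℂ)
        (g.2.1 : Matrix (Fin n × Fin n) (Fin n × Fin n) ℂ)
        (g.2.2 : Matrix (Fin n × Fin n) (Fin n × Fin n) ℂ) (matMulTensor ℂ n n n) a b c =
      if α a + β b + γ c = 0 then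
        actTensor (k.1 : Matrix (Fin n × Fin n) (Fin n × Fin n) ℂ)
          (k.2.1 : Matrix (Fin n × Fin n) (Fin n × Fin n) ℂ)
          (k.2.2 : Matrix (Fin n × Fin n) (Fin n × Fin n) ℂ) T a b c
      else 0 := hP2
  have hXsupp : ∀ a b c,
      actTensor (g.1 : Matrix (Fin n × Fin n) (Fin n × Fin n) ℂ)
        (g.2.1 : Matrix (Fin n × Fin n) (Fin n × Fin n) ℂ)
        (g.2.2 : Matrix (Fin n × Fin n) (Fin n × Fin n) ℂ)
        (matMulTensor ℂ n n n) a b c ≠ 0 → α a + β b + γ c = 0 := by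
    intro a b c hne
    by_contra hw
    exact hne (by rw [hP2' a b c, if_neg hw])
  -- straightening
  obtain ⟨s₁, s₂, s₃, α', β', γ', hs₁, hs₂, hs₃, hsM, hgr₁, hgr₂, hgr₃⟩ :=
    straighten hn (g.1 : Matrix (Fin n × Fin n) (Fin n × Fin n) ℂ)
      (g.2.1 : Matrix (Fin n × Fin n) (Fin n × Fin n) ℂ)
      (g.2.2 : Matrix (Fin n × Fin n) (Fin n × Fin n) ℂ) g.1.2 g.2.1.2 g.2.2.2 α β γ hXsupp
  let S₁ : Matrix.SpecialLinearGroup (Fin n × Fin n) ℂ := ⟨s₁, hs₁⟩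
  let S₂ : Matrix.SpecialLinearGroup (Fin n × Fin n) ℂ := ⟨s₂, hs₂⟩
  let S₃ : Matrix.SpecialLinearGroup (Fin n × Fin n) ℂ := ⟨s₃, hs₃⟩
  have hS₁ : ((S₁ * k.1 : Matrix.SpecialLinearGroup (Fin n × Fin n) ℂ) :
      Matrix (Fin n × Fin n) (Fin n × Fin n) ℂ) =
      s₁ * (k.1 : Matrix (Fin n × Fin n) (Fin n × Fin n) ℂ) := by
    rw [Matrix.SpecialLinearGroup.coe_mul]
  have hS₂ : ((S₂ * k.2.1 : Matrix.SpecialLinearGroup (Fin n × Fin n) ℂ) :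
      Matrix (Fin n × Fin n) (Fin n × Fin n) ℂ) =
      s₂ * (k.2.1 : Matrix (Fin n × Fin n) (Fin n × Fin n) ℂ) := by
    rw [Matrix.SpecialLinearGroup.coe_mul]
  have hS₃ : ((S₃ * k.2.2 : Matrix.SpecialLinearGroup (Fin n × Fin n) ℂ) :
      Matrix (Fin n × Fin n) (Fin n × Fin n) ℂ) =
      s₃ * (k.2.2 : Matrix (Fin n × Fin n) (Fin n × Fin n) ℂ) := by
    rw [Matrix.SpecialLinearGroup.coe_mul]
  refine ⟨(S₁ * k.1, S₂ * k.2.1, S₃ * k.2.2), α', β', γ', ?_, ?_⟩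
  · -- (W0): gradedness of `s` and the support of `X`
    intro a b c hne
    rw [← hsM, actTensor_apply] at hne
    obtain ⟨a', -, ha'⟩ := Finset.exists_ne_zero_of_sum_ne_zero hne
    obtain ⟨b', -, hb'⟩ := Finset.exists_ne_zero_of_sum_ne_zero ha'
    obtain ⟨c', -, hc'⟩ := Finset.exists_ne_zero_of_sum_ne_zero hb'
    have h1 : s₁ a a' ≠ 0 := left_ne_zero_of_mul (left_ne_zero_of_mul (left_ne_zero_of_mul hc'))
    have h2 : s₂ b b' ≠ 0 := right_ne_zero_of_mul (left_ne_zero_of_mul (left_ne_zero_of_mul hc'))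
    have h3 : s₃ c c' ≠ 0 := right_ne_zero_of_mul (left_ne_zero_of_mul hc')
    have h4 := right_ne_zero_of_mul hc'
    rw [hgr₁ a a' h1, hgr₂ b b' h2, hgr₃ c c' h3]
    exact hXsupp a' b' c' h4
  · -- (W1): termwise comparison of `s·(k·T)` with `s·X = M`
    intro a b c hle
    show actTensor ((S₁ * k.1 : Matrix.SpecialLinearGroup (Fin n × Fin n) ℂ) :
          Matrix (Fin n × Fin n) (Fin n × Fin n) ℂ)
      ((S₂ * k.2.1 : Matrix.SpecialLinearGroup (Fin n × Fin n) ℂ) :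
          Matrix (Fin n × Fin n) (Fin n × Fin n) ℂ)
      ((S₃ * k.2.2 : Matrix.SpecialLinearGroup (Fin n × Fin n) ℂ) :
          Matrix (Fin n × Fin n) (Fin n × Fin n) ℂ) T a b c = matMulTensor ℂ n n n a b c
    rw [hS₁, hS₂, hS₃]
    rw [← actTensor_actTensor, ← hsM, actTensor_apply, actTensor_apply]
    refine Finset.sum_congr rfl fun a' _ => Finset.sum_congr rfl fun b' _ =>
      Finset.sum_congr rfl fun c' _ => ?_
    by_cases h1 : s₁ a a' = 0
    · simp [h1]
    by_cases h2 : s₂ b b' = 0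
    · simp [h2]
    by_cases h3 : s₃ c c' = 0
    · simp [h3]
    have hw : α a' + β b' + γ c' ≤ 0 := by
      rw [← hgr₁ a a' h1, ← hgr₂ b b' h2, ← hgr₃ c c' h3]; exact hle
    congr 1
    rcases hw.lt_or_eq with hlt | heq
    · rw [hP1' a' b' c' hlt, hP2' a' b' c', if_neg hlt.ne]
    · rw [hP2' a' b' c', if_pos heq]

/-- **`HilbertMumfordHalf` modulo the Hilbert–Mumford criterion** (Kempf 1978, Thm. 1.4, for
`SL_m(ℂ)³` on `3`-tensors — the only unproved input): the route's support item, with (⇐)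
unconditional (`hilbertMumfordHalf_mpr`) and (⇒) by polystability of `⟨n,n,n⟩`, Kempf's criterion
and torus straightening (`hilbertMumfordHalf_mp_of_kempf`). -/
theorem hilbertMumfordHalf_of_kempf (hK : Kempf1978_thm14_tensor) :
    Summit.MatrixMultiplication.MatrixMultiplication.Theses.ToricBorderRank.HilbertMumfordHalf :=
  fun n T =>
    ⟨fun h => hilbertMumfordHalf_mp_of_kempf hK n T h, fun h => hilbertMumfordHalf_mpr n T h⟩

end Summit.MatrixMultiplication.MatrixMultiplication.Theorems
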